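import Literature.MathematicalPhysics.QuantumFieldTheory.Balaban1983to89.Beta.GaussianIntegral
import Mathlib.MeasureTheory.Measure.Haar.NormedSpace
import HarnessLib

/-!
# S2-GAUSS: the finite-`λ` Gaussian normalisation identity — a chart-side fibre integral `∫ G(x)·e^{−β⟨x,Hx⟩∕2} dx` IS
# `Cl(β) · (det H)^{−1∕2} · E_{H⁻¹}[G((√β)⁻¹ •)]` with `Cl(β) = √(2π∕β)^{|ι|}` DATUM-FREE and `E` GREP's normalised-expectation letter

Cell `ym3-torus` (YM ladder rung R3 = continuum `SU(2)` Yang–Mills on the three-torus — a RUNG, NOT d = 4, NOT infinite volume, NOT a mass gap, NOT Clay).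
Width seat `ym3-torus-px20` (gen 16); `--supports stmt-QuantumFields-20520 --as helper`, count-neutral, definition-free, default heartbeats; registry v11.4 №36
untouched.  BLUEPRINT-ECE₁ (evidence on stmt-QuantumFields-20520, px20 g15) step S2: on the window, after charting the fibre around the minimiser and factoring
`e^{−β_λ m(U)}`, the one-step fluctuation integral is a Lebesgue integral `∫_{ι → ℝ} G(x)·exp(−β_λ·⟨x, H_U x⟩∕2) dx` over the transversal coordinates (`H_U` = the
transversal Hessian letter, positive definite by GAP♯∘; `G` = cut × Jacobian ratio × `e^{−β_λ R₃}`).  The product formula that ✓`LoopLedgerGasOfProductFormula.gasAt_of_productFormula`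
consumes wants this written as `Cl λ · ell U · (bracket)` with `Cl` DATUM-FREE, `ell` λ-FREE and the bracket a normalised Gaussian expectation in the covariance `C := H_U⁻¹` —
the letter `E Cv K := (∫ φ, K φ · exp(−(φ ⬝ᵥ (Cv⁻¹ *ᵥ φ))∕2)) ∕ ∫ φ, exp(−(φ ⬝ᵥ (Cv⁻¹ *ᵥ φ))∕2)` of GREP (✓`AnchorGap.stub_gaussianBBFPolymerRep`), so that S4∕S5
(✓`LoopLedgerGasSingletonAbsorption.gas_of_normalised_gas`, ✓`LoopLedgerGasOfAtomGas`) continue from it.  This file is that change of variables, generic over a finite index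
type `ι`, with NO hypothesis on `G` (Mathlib's `Measure.integral_comp_inv_smul_of_nonneg` holds for every integrand under the junk-value convention):
* §1 `smul_dotProduct_mulVec_smul`, `mul_quadForm_inv_sqrt_smul` (`β·⟨(√β)⁻¹φ, H (√β)⁻¹φ⟩ = ⟨φ, Hφ⟩`), ★`integral_eq_inv_sqrt_pow_mul_integral_comp_smul` (`∫ f = (√β)^{−|ι|}·∫ f((√β)⁻¹•·)`),
  ★`integral_mul_exp_neg_mul_quadForm` (the scaling: `∫ G e^{−β⟨x,Hx⟩∕2} = (√β)^{−|ι|} ∫ G((√β)⁻¹φ) e^{−⟨φ,Hφ⟩∕2}`).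
* §2 `integral_exp_neg_quadForm_div_two` (the tree's KERNEL theorem ✓`Beta.GaussianIntegral.integral_exp_neg_half_quadForm` in the `∕2` spelling: `√(2π)^{|ι|} ∕ √(det H)`), its
  positivity, `nonsing_inv_inv_of_posDef` (`(H⁻¹)⁻¹ = H`, so GREP's letter at `Cv := H⁻¹` carries the precision `H`; GREP's `C.PosDef` at `C := H⁻¹` is Mathlib's
  `Matrix.PosDef.inv`), `expect_const_one` (`E_{H⁻¹}[1] = 1`).
* §3 ★★`integral_mul_exp_eq_cl_mul_ell_mul_expect` — THE DOOR: `∫ G·e^{−β⟨x,Hx⟩∕2} = √(2π∕β)^{|ι|} · (√det H)⁻¹ · E_{H⁻¹}[G((√β)⁻¹•·)]` (GREP's letter VERBATIM at `Cv := H⁻¹`);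
  ★★`integral_mul_exp_eq_cl_mul_sqrt_det_mul_expect` — the same in the COVARIANCE currency (`C` positive definite, precision `C⁻¹`, `ell = √(det C)`).
* §4 ★★`integral_mul_exp_neg_mul_action_mul_exp_eq` — the `h·e^{b} = C·l·Z` shape of ✓`LoopLedgerGasOfProductFormula.log_add_eq_of_mul_exp_eq`: for an action split
  `A x = m + ⟨x,Hx⟩∕2 + R x` (minimum value `m`, Hessian `H`, Taylor remainder `R`), `(∫ g·e^{−βA})·e^{βm} = Cl(β)·(√det H)⁻¹·E_{H⁻¹}[g((√β)⁻¹φ)·e^{−β R((√β)⁻¹φ)}]` — the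
  VERTEX of S6 is visible: the remainder enters only through `β·R((√β)⁻¹φ)`.
* §5 the constants: `cl_pos`, `cl_eq_rpow` (`√(2π∕β)^{|ι|} = (2π∕β)^{|ι|∕2}`), `log_cl`, `log_inv_sqrt_det` (`= −½·log det H`, the one-loop letter), `inv_sqrt_det_pos`.

HONEST SCOPE.  [folklore] a linear change of variables and the Gaussian integral (the tree's kernel theorem, BY NAME); nothing of the chart (EXW∘), of the gap (GAP♯∘), of GREP's
hypotheses on the scaled integrand (S3∕S6), of the datum-locality gap (S7), of Bałaban's expansions, of GAS∕GAS₁∕REP∕H4ᶜ∕S2β or of `FluctuationComparisonRegPrIntL`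
(stmt-QuantumFields-20520) is proved; no summit statement is proved by a helper; rung R3 = SU(2) YM₃ on T³ — NOT d = 4, NOT infinite volume, NOT a mass gap, NOT Clay; the
Yang–Mills mass gap is NOT proved.

References: T. Bałaban, CMP **102** (1985) 255–275 [Balaban1985UV3] ((45)–(47): the small-field cluster expansion after the background-field split); D. C. Brydges, *A short
course on cluster expansions*, Les Houches 1984 [Brydges1986] §3; J. Glimm, A. Jaffe, *Quantum Physics* (1987) §9.1 (Gaussian integrals) [GlimmJaffe1987].
-/

set_option autoImplicit false

noncomputable section

open MeasureTheory Matrix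
open scoped Real

namespace Summit.QuantumFields.YangMills.Theorems.LoopLedgerGaussianScaling

open Literature.MathematicalPhysics.QuantumFieldTheory.Balaban1983to89

variable {ι : Type*} [Fintype ι] [DecidableEq ι]

/-! ## §1 The scaling `x = (√β)⁻¹ • φ` -/

omit [DecidableEq ι] in
/-- `⟨c•φ, H(c•φ)⟩ = c²·⟨φ, Hφ⟩`. [folklore] -/
theorem smul_dotProduct_mulVec_smul (c : ℝ) (H : Matrix ι ι ℝ) (φ : ι → ℝ) :
    (c • φ) ⬝ᵥ (H *ᵥ (c • φ)) = c ^ 2 * (φ ⬝ᵥ (H *ᵥ φ)) := by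
  rw [Matrix.mulVec_smul, dotProduct_smul, smul_dotProduct, smul_eq_mul, smul_eq_mul]
  ring

omit [DecidableEq ι] in
/-- `β·⟨(√β)⁻¹φ, H (√β)⁻¹φ⟩ = ⟨φ, Hφ⟩` for `β > 0`: the scaling removes `β` from the Gaussian weight. [folklore] -/
theorem mul_quadForm_inv_sqrt_smul {β : ℝ} (hβ : 0 < β) (H : Matrix ι ι ℝ) (φ : ι → ℝ) :
    β * (((Real.sqrt β)⁻¹ • φ) ⬝ᵥ (H *ᵥ ((Real.sqrt β)⁻¹ • φ))) = φ ⬝ᵥ (H *ᵥ φ) := by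
  rw [smul_dotProduct_mulVec_smul, inv_pow, Real.sq_sqrt hβ.le, ← mul_assoc, mul_inv_cancel₀ hβ.ne', one_mul]

omit [DecidableEq ι] in
/-- ★ the linear substitution `x = (√β)⁻¹ • φ` in a Lebesgue integral over `ι → ℝ`: `∫ f = (√β)^{−|ι|} · ∫ f((√β)⁻¹ • φ) dφ` — for EVERY `f` (Mathlib's
`Measure.integral_comp_inv_smul_of_nonneg`, junk-value convention included). [folklore] -/
theorem integral_eq_inv_sqrt_pow_mul_integral_comp_smul {β : ℝ} (hβ : 0 < β) (f : (ι → ℝ) → ℝ) :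
    ∫ x, f x = ((Real.sqrt β) ^ Fintype.card ι)⁻¹ * ∫ φ, f ((Real.sqrt β)⁻¹ • φ) := by
  have h := Measure.integral_comp_inv_smul_of_nonneg (volume : Measure (ι → ℝ)) f (Real.sqrt_nonneg β)
  rw [Module.finrank_fintype_fun_eq_card, smul_eq_mul] at h
  rw [h, ← mul_assoc, inv_mul_cancel₀ (pow_ne_zero _ (Real.sqrt_pos.2 hβ).ne'), one_mul]

omit [DecidableEq ι] in
/-- ★ **the scaling**: `∫ G(x)·e^{−β⟨x,Hx⟩∕2} dx = (√β)^{−|ι|} · ∫ G((√β)⁻¹φ)·e^{−⟨φ,Hφ⟩∕2} dφ` (`β > 0`; any `H`, any `G`). [folklore] -/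
theorem integral_mul_exp_neg_mul_quadForm {β : ℝ} (hβ : 0 < β) (H : Matrix ι ι ℝ) (G : (ι → ℝ) → ℝ) :
    ∫ x, G x * Real.exp (-(β * (x ⬝ᵥ (H *ᵥ x))) / 2)
      = ((Real.sqrt β) ^ Fintype.card ι)⁻¹ *
          ∫ φ, G ((Real.sqrt β)⁻¹ • φ) * Real.exp (-(φ ⬝ᵥ (H *ᵥ φ)) / 2) := by
  rw [integral_eq_inv_sqrt_pow_mul_integral_comp_smul hβ]
  congr 1
  refine integral_congr_ae (Filter.Eventually.of_forall fun φ => ?_)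
  simp only
  rw [mul_quadForm_inv_sqrt_smul hβ]

/-! ## §2 The Gaussian normalisation and GREP's covariance letter -/

/-- the tree's kernel Gaussian integral ✓`Beta.GaussianIntegral.integral_exp_neg_half_quadForm` in the `∕2` spelling of GREP's letter:
`∫ e^{−⟨φ,Hφ⟩∕2} dφ = √(2π)^{|ι|} ∕ √(det H)` for `H` positive definite. [folklore] -/
theorem integral_exp_neg_quadForm_div_two {H : Matrix ι ι ℝ} (hH : H.PosDef) :
    ∫ φ : ι → ℝ, Real.exp (-(φ ⬝ᵥ (H *ᵥ φ)) / 2) = Real.sqrt (2 * π) ^ Fintype.card ι / Real.sqrt H.det := by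
  have h : ∀ φ : ι → ℝ, -(φ ⬝ᵥ (H *ᵥ φ)) / 2 = -(1 / 2 : ℝ) * (φ ⬝ᵥ H *ᵥ φ) := fun φ => by ring
  simp_rw [h]
  exact Beta.GaussianIntegral.integral_exp_neg_half_quadForm H hH

/-- the Gaussian normalisation is positive. [folklore] -/
theorem integral_exp_neg_quadForm_div_two_pos {H : Matrix ι ι ℝ} (hH : H.PosDef) :
    0 < ∫ φ : ι → ℝ, Real.exp (-(φ ⬝ᵥ (H *ᵥ φ)) / 2) := by
  rw [integral_exp_neg_quadForm_div_two hH]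
  exact div_pos (pow_pos (Real.sqrt_pos.2 (by positivity)) _) (Real.sqrt_pos.2 hH.det_pos)

/-- `(H⁻¹)⁻¹ = H` for a positive definite `H`: GREP's expectation letter `E Cv` at the covariance `Cv := H⁻¹` carries the precision `H`. [folklore] -/
theorem nonsing_inv_inv_of_posDef {H : Matrix ι ι ℝ} (hH : H.PosDef) : H⁻¹⁻¹ = H :=
  Matrix.nonsing_inv_nonsing_inv H (isUnit_iff_ne_zero.2 hH.det_pos.ne')

/-- `E_{H⁻¹}[1] = 1`: GREP's normalised expectation of the constant `1` (the trivial-field∕empty-remainder value). [folklore] -/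
theorem expect_const_one {H : Matrix ι ι ℝ} (hH : H.PosDef) :
    (∫ φ : ι → ℝ, (1 : ℝ) * Real.exp (-(φ ⬝ᵥ (H⁻¹⁻¹ *ᵥ φ)) / 2)) / ∫ φ : ι → ℝ, Real.exp (-(φ ⬝ᵥ (H⁻¹⁻¹ *ᵥ φ)) / 2) = 1 := by
  simp_rw [one_mul]
  rw [nonsing_inv_inv_of_posDef hH]
  exact div_self (integral_exp_neg_quadForm_div_two_pos hH).ne'

/-! ## §3 The door -/

/-- ★★ **THE FINITE-`λ` GAUSSIAN NORMALISATION IDENTITY (S2-GAUSS).**  For `β > 0`, `H` positive definite and ANY `G`: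
`∫ G(x)·e^{−β⟨x,Hx⟩∕2} dx = √(2π∕β)^{|ι|} · (√det H)⁻¹ · E_{H⁻¹}[G((√β)⁻¹ • ·)]`, where the last factor is GREP's normalised-expectation letter
`(∫ φ, K φ · exp(−(φ ⬝ᵥ (Cv⁻¹ *ᵥ φ))∕2)) ∕ ∫ φ, exp(−(φ ⬝ᵥ (Cv⁻¹ *ᵥ φ))∕2)` VERBATIM at `Cv := H⁻¹`, `K φ := G((√β)⁻¹ • φ)`.  `Cl(β) := √(2π∕β)^{|ι|}` is datum-free,
`(√det H)⁻¹` is `β`-free. [folklore] -/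
theorem integral_mul_exp_eq_cl_mul_ell_mul_expect {β : ℝ} (hβ : 0 < β) {H : Matrix ι ι ℝ} (hH : H.PosDef) (G : (ι → ℝ) → ℝ) :
    ∫ x, G x * Real.exp (-(β * (x ⬝ᵥ (H *ᵥ x))) / 2)
      = Real.sqrt (2 * π / β) ^ Fintype.card ι * (Real.sqrt H.det)⁻¹ *
        ((∫ φ, G ((Real.sqrt β)⁻¹ • φ) * Real.exp (-(φ ⬝ᵥ (H⁻¹⁻¹ *ᵥ φ)) / 2))
          / ∫ φ, Real.exp (-(φ ⬝ᵥ (H⁻¹⁻¹ *ᵥ φ)) / 2)) := by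
  rw [nonsing_inv_inv_of_posDef hH, integral_mul_exp_neg_mul_quadForm hβ, integral_exp_neg_quadForm_div_two hH,
    Real.sqrt_div' _ hβ.le, div_pow]
  have h1 : (0 : ℝ) < Real.sqrt β ^ Fintype.card ι := pow_pos (Real.sqrt_pos.2 hβ) _
  have h2 : (0 : ℝ) < Real.sqrt (2 * π) ^ Fintype.card ι := pow_pos (Real.sqrt_pos.2 (by positivity)) _
  have h3 : (0 : ℝ) < Real.sqrt H.det := Real.sqrt_pos.2 hH.det_pos
  field_simp

/-- ★★ the same door in the COVARIANCE currency (GREP's own: `C` positive definite is the covariance, `C⁻¹` the precision, and `√det C = (√det C⁻¹)⁻¹`):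
`∫ G(x)·e^{−β⟨x,C⁻¹x⟩∕2} dx = √(2π∕β)^{|ι|} · √(det C) · E_C[G((√β)⁻¹ • ·)]`. [folklore] -/
theorem integral_mul_exp_eq_cl_mul_sqrt_det_mul_expect {β : ℝ} (hβ : 0 < β) {C : Matrix ι ι ℝ} (hC : C.PosDef) (G : (ι → ℝ) → ℝ) :
    ∫ x, G x * Real.exp (-(β * (x ⬝ᵥ (C⁻¹ *ᵥ x))) / 2)
      = Real.sqrt (2 * π / β) ^ Fintype.card ι * Real.sqrt C.det *
        ((∫ φ, G ((Real.sqrt β)⁻¹ • φ) * Real.exp (-(φ ⬝ᵥ (C⁻¹ *ᵥ φ)) / 2))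
          / ∫ φ, Real.exp (-(φ ⬝ᵥ (C⁻¹ *ᵥ φ)) / 2)) := by
  have h := integral_mul_exp_eq_cl_mul_ell_mul_expect hβ hC.inv G
  rw [nonsing_inv_inv_of_posDef hC] at h
  rw [h, Matrix.det_nonsing_inv, Ring.inverse_eq_inv', Real.sqrt_inv, inv_inv]

/-! ## §4 The `h·e^{b} = C·l·Z` currency of the product-formula socket -/

omit [DecidableEq ι] in
/-- moving the minimum value out: `g·e^{−βA}·e^{βm} = (g·e^{−βR})·e^{−β⟨x,Hx⟩∕2}` when `A x = m + ⟨x,Hx⟩∕2 + R x`. [folklore] -/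
theorem mul_exp_neg_mul_action_mul_exp {β m : ℝ} {H : Matrix ι ι ℝ} {A R : (ι → ℝ) → ℝ}
    (hA : ∀ x, A x = m + (x ⬝ᵥ (H *ᵥ x)) / 2 + R x) (g : (ι → ℝ) → ℝ) (x : ι → ℝ) :
    g x * Real.exp (-(β * A x)) * Real.exp (β * m)
      = (g x * Real.exp (-(β * R x))) * Real.exp (-(β * (x ⬝ᵥ (H *ᵥ x))) / 2) := by
  rw [hA x, mul_assoc, ← Real.exp_add, mul_assoc, ← Real.exp_add]
  congr 2
  ring

/-- ★★ **the product-formula currency.**  For an action split `A x = m + ⟨x,Hx⟩∕2 + R x` on the chart (`m` the minimum value, `H` the positive definite Hessian letter, `R`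
the Taylor remainder, all fixed data of the datum) and `β > 0`:
`(∫ g·e^{−βA}) · e^{βm} = √(2π∕β)^{|ι|} · (√det H)⁻¹ · E_{H⁻¹}[g((√β)⁻¹φ) · e^{−β·R((√β)⁻¹φ)}]`
— literally the `h * exp b = C * l * Z` hypothesis shape of ✓`LoopLedgerGasOfProductFormula.log_add_eq_of_mul_exp_eq` with `C := Cl(β)` datum-free and `l := (√det H)⁻¹`
`β`-free; the VERTEX of BLUEPRINT S6 is the scaled remainder `β·R((√β)⁻¹φ)` (cubic and higher in `φ` with `(√β)⁻¹` per extra leg). [folklore] -/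
theorem integral_mul_exp_neg_mul_action_mul_exp_eq {β m : ℝ} (hβ : 0 < β) {H : Matrix ι ι ℝ} (hH : H.PosDef) {A R : (ι → ℝ) → ℝ}
    (hA : ∀ x, A x = m + (x ⬝ᵥ (H *ᵥ x)) / 2 + R x) (g : (ι → ℝ) → ℝ) :
    (∫ x, g x * Real.exp (-(β * A x))) * Real.exp (β * m)
      = Real.sqrt (2 * π / β) ^ Fintype.card ι * (Real.sqrt H.det)⁻¹ *
        ((∫ φ, (g ((Real.sqrt β)⁻¹ • φ) * Real.exp (-(β * R ((Real.sqrt β)⁻¹ • φ)))) * Real.exp (-(φ ⬝ᵥ (H⁻¹⁻¹ *ᵥ φ)) / 2))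
          / ∫ φ, Real.exp (-(φ ⬝ᵥ (H⁻¹⁻¹ *ᵥ φ)) / 2)) := by
  rw [← integral_mul_const]
  simp_rw [mul_exp_neg_mul_action_mul_exp hA]
  exact integral_mul_exp_eq_cl_mul_ell_mul_expect hβ hH _

/-! ## §5 The constants -/

omit [Fintype ι] [DecidableEq ι] in
/-- `Cl(β) = √(2π∕β)^{n} > 0`. [folklore] -/
theorem cl_pos {β : ℝ} (hβ : 0 < β) (n : ℕ) : 0 < Real.sqrt (2 * π / β) ^ n :=
  pow_pos (Real.sqrt_pos.2 (by positivity)) _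

omit [Fintype ι] [DecidableEq ι] in
/-- `√(2π∕β)^{n} = (2π∕β)^{n∕2}` (the real-exponent spelling of BLUEPRINT S2's `Cl λ = (2π)^{dV∕2} β_λ^{−dV∕2}`). [folklore] -/
theorem cl_eq_rpow {β : ℝ} (hβ : 0 < β) (n : ℕ) : Real.sqrt (2 * π / β) ^ n = (2 * π / β) ^ ((n : ℝ) / 2) := by
  rw [Real.sqrt_eq_rpow, ← Real.rpow_natCast, ← Real.rpow_mul (by positivity)]
  ring_nf

omit [Fintype ι] [DecidableEq ι] in
/-- `log Cl(β) = (n∕2)·(log 2π − log β)` — the datum-free constant `a λ` of the product-formula split. [folklore] -/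
theorem log_cl {β : ℝ} (hβ : 0 < β) (n : ℕ) :
    Real.log (Real.sqrt (2 * π / β) ^ n) = (n : ℝ) / 2 * (Real.log (2 * π) - Real.log β) := by
  rw [Real.log_pow, Real.log_sqrt (by positivity), Real.log_div (by positivity) hβ.ne']
  ring

/-- `(√det H)⁻¹ > 0`: the `ell` letter is positive. [folklore] -/
theorem inv_sqrt_det_pos {H : Matrix ι ι ℝ} (hH : H.PosDef) : 0 < (Real.sqrt H.det)⁻¹ :=
  inv_pos.2 (Real.sqrt_pos.2 hH.det_pos)

/-- `log (√det H)⁻¹ = −½·log det H` — the one-loop letter (what `oneLoopPartCan U = log (ell U) − log (ell 1)` reads on the window). [folklore] -/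
theorem log_inv_sqrt_det {H : Matrix ι ι ℝ} (hH : H.PosDef) :
    Real.log (Real.sqrt H.det)⁻¹ = -(1 / 2 : ℝ) * Real.log H.det := by
  rw [Real.log_inv, Real.log_sqrt hH.det_pos.le]
  ring

end Summit.QuantumFields.YangMills.Theorems.LoopLedgerGaussianScaling

end
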